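import Summits.AtomisticToContinuum.HydrodynamicLimit.Theorems.JParityClosureLocalSecondLawLedgerTwins
import Summits.AtomisticToContinuum.HydrodynamicLimit.Theorems.JParityClosureLocalSecondLawLedgerObs
import Literature.Analysis.FunctionSpaces.TorusHolderBridge

/-!
# Entropy ledger for `JParityClosure.LocalSecondLaw` — uniform bounds along a bounded-velocity orbit
(stmt-AtomisticToContinuum-13081, line `exact-entropy-ledger-three-passivities`, layer 11 of stub L)

Explicit Lipschitz constants, uniform over all configurations whose particle speeds are at most `V`, of the
twin coarse velocity `u_r` and of `φ/θ_r` (twin temperature), whence uniform bounds of the crux's partial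
derivatives `∂ₖ u_{r,l}` and `∂ₖ(φ/θ_r)` (`|∂ₖ f| ≤ Lip f`, junk value included); and uniform bounds of all
jointly continuous factors of the ledger's integrands on the compact box
`[0, τ] × {speeds ≤ V} × 𝕋³`.  Along a good orbit the speeds are bounded by energy conservation.

References: H. Federer, *Geometric Measure Theory* (1969) 3.1.
-/

noncomputable section

namespace Summit.AtomisticToContinuum.HydrodynamicLimit.Theorems.LocalSecondLawLedger

open scoped BigOperators Topology ENNReal InnerProductSpace NNReal
open Filter Set MeasureTheory
open Literature.MathematicalPhysics.KineticTheory
open Literature.Analysis.FluidPDE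
open Literature.Analysis.FunctionSpaces
open Summit.AtomisticToContinuum.HydrodynamicLimit.Theorems.LocalSecondLawNegative

namespace L

variable {N : ℕ}

/-! ## The bounded-velocity box -/

/-- Configurations all of whose particle speeds are at most `V`. [folklore] -/
def KV (N : ℕ) (V : ℝ) : Set (Phase N) := {w | ∀ i, ‖(w i).2‖ ≤ V}

/-- The bounded-velocity box is compact (Tychonov). [folklore] -/
theorem isCompact_KV (N : ℕ) (V : ℝ) : IsCompact (KV N V) := by
  have h : KV N V = Set.pi Set.univ fun _ : Fin (N + 1) => (Set.univ : Set T3) ×ˢ Metric.closedBall (0 : V3) V := by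
    ext w
    simp only [KV, Set.mem_setOf_eq, Set.mem_univ_pi, Set.mem_prod, Set.mem_univ, true_and,
      Metric.mem_closedBall, dist_zero_right]
  rw [h]
  exact isCompact_univ_pi fun _ => isCompact_univ.prod (isCompact_closedBall _ _)

/-- Along a good orbit every particle speed is bounded by the (conserved) total kinetic energy. [folklore] -/
theorem flow_mem_KV {σ : ℝ} (Φ : Flow σ N) {z : Phase N} (hz : z ∈ Φ.good) (s : ℝ) :
    Φ.flow s z ∈ KV N (Real.sqrt (2 * configEnergy z)) := by
  intro i
  have hE : configEnergy (Φ.flow s z) = configEnergy z := by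
    have h := IsHardSphereTrajectory.configEnergy_eq_holds (Φ.isTrajectory z hz) s 0
    rwa [Φ.flow_zero z hz] at h
  have hle : ‖(Φ.flow s z i).2‖ ^ 2 ≤ 2 * configEnergy z := by
    rw [← hE, configEnergy]
    have := Finset.single_le_sum (f := fun j => ‖(Φ.flow s z j).2‖ ^ 2) (fun j _ => sq_nonneg _) (Finset.mem_univ i)
    linarith
  exact Real.le_sqrt_of_sq_le hle

/-- A jointly continuous function is bounded on `[0, τ] × KV × 𝕋³`. [folklore] -/
theorem exists_bound_on_box {G : ℝ × Phase N × T3 → ℝ} (hG : Continuous G) (τ V : ℝ) :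
    ∃ C, ∀ s ∈ Set.Icc 0 τ, ∀ w ∈ KV N V, ∀ x : T3, |G (s, w, x)| ≤ C := by
  have hK : IsCompact (Set.Icc 0 τ ×ˢ (KV N V ×ˢ (Set.univ : Set T3))) :=
    isCompact_Icc.prod ((isCompact_KV N V).prod isCompact_univ)
  obtain ⟨C, hC⟩ := hK.exists_bound_of_continuousOn hG.continuousOn
  exact ⟨C, fun s hs w hw x => by simpa [Real.norm_eq_abs] using hC (s, w, x) ⟨hs, hw, Set.mem_univ _⟩⟩

/-- A continuous function of configuration and field point is bounded on `KV × 𝕋³`. [folklore] -/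
theorem exists_bound_on_KV {G : Phase N × T3 → ℝ} (hG : Continuous G) (V : ℝ) :
    ∃ C, ∀ w ∈ KV N V, ∀ x : T3, |G (w, x)| ≤ C := by
  obtain ⟨C, hC⟩ := ((isCompact_KV N V).prod isCompact_univ).exists_bound_of_continuousOn hG.continuousOn
  exact ⟨C, fun w hw x => by simpa [Real.norm_eq_abs] using hC (w, x) ⟨hw, Set.mem_univ _⟩⟩

/-! ## Explicit bounds and Lipschitz constants on the box -/

section Explicit

variable {r c V : ℝ} (hr : 0 < r) (hc : 0 < c) (hV : 0 ≤ V) {w : Phase N} (hw : w ∈ KV N V)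
include hr hV hw

omit hr hV in
/-- Velocity-weighted averages over the particles are bounded on the box. [folklore] -/
theorem avg_abs_vel_le (l : Fin 3) : ((N + 1 : ℕ) : ℝ)⁻¹ * ∑ i, |(w i).2 l| ≤ V := by
  calc ((N + 1 : ℕ) : ℝ)⁻¹ * ∑ i, |(w i).2 l| ≤ ((N + 1 : ℕ) : ℝ)⁻¹ * ∑ _i : Fin (N + 1), V :=
        mul_le_mul_of_nonneg_left (Finset.sum_le_sum fun i _ =>
          (le_trans (by simpa only [Real.norm_eq_abs] using PiLp.norm_apply_le (w i).2 l) (hw i))) (by positivity)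
    _ = V := by rw [Finset.sum_const, Finset.card_univ, Fintype.card_fin, nsmul_eq_mul]; field_simp

omit hV in
/-- `|m_{r,l}| ≤ (3/(πr³)) V` on the box. [folklore] -/
theorem abs_momC_le_box (x : T3) (l : Fin 3) : |momC r w x l| ≤ 3 / (Real.pi * r ^ 3) * V := by
  rw [momC_apply_eq_sum]
  exact (abs_cone_avg_le hr w x fun i => (w i).2 l).trans
    (mul_le_mul_of_nonneg_left (avg_abs_vel_le hw l) (by positivity))

/-- `m_{r,l}` is `(3√3/(πr⁴)) V`-Lipschitz on the box. [folklore] -/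
theorem lipschitzWith_momC_box (l : Fin 3) : LipschitzWith (coneLip r * Real.toNNReal V) fun x => momC r w x l := by
  have h : ∀ i ∈ (Finset.univ : Finset (Fin (N + 1))),
      LipschitzWith (Real.toNNReal |(w i).2 l| * coneLip r) fun x => cone r (w i).1 x * (w i).2 l := fun i _ => by
    simpa only [mul_comm (cone r _ _)] using lipschitzWith_const_mul' (lipschitzWith_cone_right hr (w i).1) ((w i).2 l)
  have hs := lipschitzWith_const_mul' (lipschitzWith_finset_sum _ h) (((N + 1 : ℕ) : ℝ)⁻¹)
  have hfun : (fun x => momC r w x l) = fun x => ((N + 1 : ℕ) : ℝ)⁻¹ * ∑ i, cone r (w i).1 x * (w i).2 l :=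
    funext fun x => momC_apply_eq_sum r w x l
  rw [hfun]
  refine hs.weaken ?_
  rw [← NNReal.coe_le_coe]
  have havg := avg_abs_vel_le hw l
  push_cast at havg ⊢
  simp only [Real.coe_toNNReal _ (abs_nonneg _), Real.coe_toNNReal _ hV]
  rw [abs_of_nonneg (by positivity : (0 : ℝ) ≤ ((N : ℝ) + 1)⁻¹), ← Finset.sum_mul]
  nlinarith [havg, (coneLip r).2]

omit hV hw in
/-- The twin density is `3√3/(πr⁴)`-Lipschitz. [folklore] -/
theorem lipschitzWith_rhoT : LipschitzWith (coneLip r) (rhoT r c w) := by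
  have h : ∀ i ∈ (Finset.univ : Finset (Fin (N + 1))), LipschitzWith (coneLip r) fun x => cone r (w i).1 x :=
    fun i _ => lipschitzWith_cone_right hr (w i).1
  have hs := lipschitzWith_const_mul' (lipschitzWith_finset_sum _ h) (((N + 1 : ℕ) : ℝ)⁻¹)
  have hfun : rhoC r w = fun x => ((N + 1 : ℕ) : ℝ)⁻¹ * ∑ i, cone r (w i).1 x := funext fun x => rhoC_eq_sum r w x
  have hK : Real.toNNReal |((N + 1 : ℕ) : ℝ)⁻¹| * ∑ _i : Fin (N + 1), coneLip r = coneLip r := by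
    rw [Finset.sum_const, Finset.card_univ, Fintype.card_fin, ← NNReal.coe_inj]
    push_cast
    rw [Real.coe_toNNReal _ (abs_nonneg _), abs_of_nonneg (by positivity : (0 : ℝ) ≤ ((N : ℝ) + 1)⁻¹), nsmul_eq_mul]
    push_cast
    field_simp
  unfold rhoT
  rw [hfun]
  rw [hK] at hs
  exact hs.max_const c

omit hV hw in
include hc in
/-- The inverse twin density is Lipschitz and bounded by `1/c`. [folklore] -/
theorem lipschitzWith_inv_rhoT :
    LipschitzWith (Real.toNNReal (coneLip r / c ^ 2)) (fun x => (rhoT r c w x)⁻¹) ∧ ∀ x, |(rhoT r c w x)⁻¹| ≤ c⁻¹ :=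
  ⟨lipschitzWith_inv_of_ge (lipschitzWith_rhoT hr) hc fun x => le_max_right _ _, fun x => by
    rw [abs_of_pos (inv_pos.2 (rhoT_pos hc w x))]
    exact inv_anti₀ hc (le_max_right _ _)⟩

/-- The Lipschitz constant of the twin coarse velocity on the box. [folklore] -/
def KuBox (r c V : ℝ) : NNReal :=
  Real.toNNReal (c⁻¹ * (coneLip r * Real.toNNReal V) + 3 / (Real.pi * r ^ 3) * V * Real.toNNReal (coneLip r / c ^ 2))

include hc in
/-- **The twin coarse velocity is uniformly Lipschitz on the box**, hence `|∂ₖ u_{r,l}| ≤ KuBox`. [folklore] -/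
theorem lipschitzWith_uT_box (l : Fin 3) : LipschitzWith (KuBox r c V) fun x => uT r c w x l := by
  obtain ⟨h₁, hA⟩ := lipschitzWith_inv_rhoT hr hc (w := w)
  have h₂ := lipschitzWith_momC_box hr hV hw l
  exact lipschitzWith_mul_bounded h₁ h₂ hA fun x => abs_momC_le_box hr hw x l

omit hV in
include hc in
/-- `|u_{r,l}| ≤ (3/(πr³)) V / c` on the box (twin). [folklore] -/
theorem abs_uT_le_box (x : T3) (l : Fin 3) : |uT r c w x l| ≤ c⁻¹ * (3 / (Real.pi * r ^ 3) * V) := by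
  rw [uT, abs_mul]
  exact mul_le_mul ((lipschitzWith_inv_rhoT hr hc).2 x) (abs_momC_le_box hr hw x l) (abs_nonneg _) (by positivity)

end Explicit

/-! ## Uniform Lipschitz constants of the twin temperature and of `φ/θ` on the box -/

section Theta

variable {r c V : ℝ} (hr : 0 < r) (hc : 0 < c) (hV : 0 ≤ V)
include hr hc hV

omit hc hV in
/-- `e_r` is uniformly Lipschitz and bounded on the box. [folklore] -/
theorem kinC_box {w : Phase N} (hw : w ∈ KV N V) :
    LipschitzWith (Real.toNNReal |((N + 1 : ℕ) : ℝ)⁻¹| * ∑ _i : Fin (N + 1), Real.toNNReal |V ^ 2 / 2| * coneLip r) (kinC r w)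
      ∧ ∀ x, |kinC r w x| ≤ 3 / (Real.pi * r ^ 3) * (V ^ 2 / 2) := by
  constructor
  · have h : ∀ i ∈ (Finset.univ : Finset (Fin (N + 1))),
        LipschitzWith (Real.toNNReal |V ^ 2 / 2| * coneLip r) fun x => cone r (w i).1 x * (‖(w i).2‖ ^ 2 / 2) := by
      intro i _
      have h1 := lipschitzWith_const_mul' (lipschitzWith_cone_right hr (w i).1) (‖(w i).2‖ ^ 2 / 2)
      have h2 : LipschitzWith (Real.toNNReal |V ^ 2 / 2| * coneLip r) fun x => ‖(w i).2‖ ^ 2 / 2 * cone r (w i).1 x := by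
        refine h1.weaken (mul_le_mul_left (Real.toNNReal_le_toNNReal (abs_le_abs ?_ ?_)) _)
        · exact div_le_div_of_nonneg_right (pow_le_pow_left₀ (norm_nonneg _) (hw i) 2) (by norm_num)
        · have : 0 ≤ ‖(w i).2‖ ^ 2 / 2 := by positivity
          have : 0 ≤ V ^ 2 / 2 := by positivity
          linarith
      simpa only [mul_comm (cone r _ _)] using h2
    have hs := lipschitzWith_const_mul' (lipschitzWith_finset_sum _ h) (((N + 1 : ℕ) : ℝ)⁻¹)
    have hfun : kinC r w = fun x => ((N + 1 : ℕ) : ℝ)⁻¹ * ∑ i, cone r (w i).1 x * (‖(w i).2‖ ^ 2 / 2) :=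
      funext fun x => kinC_eq_sum r w x
    rw [hfun]
    exact hs
  · intro x
    rw [kinC_eq_sum]
    refine (abs_cone_avg_le hr w x fun i => ‖(w i).2‖ ^ 2 / 2).trans (mul_le_mul_of_nonneg_left ?_ (by positivity))
    calc ((N + 1 : ℕ) : ℝ)⁻¹ * ∑ i, |‖(w i).2‖ ^ 2 / 2| ≤ ((N + 1 : ℕ) : ℝ)⁻¹ * ∑ _i : Fin (N + 1), V ^ 2 / 2 := by
          refine mul_le_mul_of_nonneg_left (Finset.sum_le_sum fun i _ => ?_) (by positivity)
          rw [abs_of_nonneg (by positivity)]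
          exact div_le_div_of_nonneg_right (pow_le_pow_left₀ (norm_nonneg _) (hw i) 2) (by norm_num)
      _ = V ^ 2 / 2 := by rw [Finset.sum_const, Finset.card_univ, Fintype.card_fin, nsmul_eq_mul]; field_simp

/-- **The twin temperature is uniformly Lipschitz on the box.** [folklore] -/
theorem exists_lipschitz_thetaT_box : ∃ K, ∀ w ∈ KV N V, LipschitzWith K (thetaT r c w) := by
  refine ⟨?_, fun w hw => ?_⟩
  swap
  obtain ⟨hi, hiA⟩ := lipschitzWith_inv_rhoT hr hc (w := w)
  obtain ⟨he, heA⟩ := kinC_box hr hw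
  have hm := fun l => lipschitzWith_momC_box hr hV hw l
  have hmA := fun x l => abs_momC_le_box hr hw x l
  have hsq : ∀ l : Fin 3, LipschitzWith _ fun x => momC r w x l * momC r w x l := fun l =>
    lipschitzWith_mul_bounded (hm l) (hm l) (fun x => hmA x l) (fun x => hmA x l)
  have hsum := lipschitzWith_finset_sum Finset.univ fun l _ => hsq l
  have hsumA : ∀ x, |∑ l : Fin 3, momC r w x l * momC r w x l| ≤ 3 * (3 / (Real.pi * r ^ 3) * V) ^ 2 := fun x => by
    refine (Finset.abs_sum_le_sum_abs _ _).trans ?_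
    calc ∑ l : Fin 3, |momC r w x l * momC r w x l| ≤ ∑ _l : Fin 3, (3 / (Real.pi * r ^ 3) * V) ^ 2 :=
          Finset.sum_le_sum fun l _ => by
            rw [abs_mul, pow_two]
            exact mul_le_mul (hmA x l) (hmA x l) (abs_nonneg _) (by positivity)
      _ = 3 * (3 / (Real.pi * r ^ 3) * V) ^ 2 := by simp
  have hii := lipschitzWith_mul_bounded hi hi hiA hiA
  have hiiA : ∀ x, |(rhoT r c w x)⁻¹ * (rhoT r c w x)⁻¹| ≤ c⁻¹ * c⁻¹ := fun x => by
    rw [abs_mul]; exact mul_le_mul (hiA x) (hiA x) (abs_nonneg _) (by positivity)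
  have h1 := lipschitzWith_mul_bounded he hi heA hiA
  have h2 := lipschitzWith_mul_bounded hsum hii hsumA hiiA
  have htot := (lipschitzWith_const_mul' (h1.sub (lipschitzWith_const_mul' h2 (1 / 2))) (2 / 3)).max_const c
  have hfun : thetaT r c w = fun x => max (2 / 3 * (kinC r w x * (rhoT r c w x)⁻¹
      - 1 / 2 * ((∑ l, momC r w x l * momC r w x l) * ((rhoT r c w x)⁻¹ * (rhoT r c w x)⁻¹)))) c := by
    funext x
    have hρ : rhoT r c w x ≠ 0 := (rhoT_pos hc w x).ne'
    unfold thetaT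
    congr 1
    simp only [pow_two]
    field_simp
  rw [hfun]
  exact htot

/-- The inverse twin temperature is uniformly Lipschitz on the box and bounded by `1/c`. [folklore] -/
theorem exists_lipschitz_inv_thetaT_box :
    ∃ K, ∀ w ∈ KV N V, LipschitzWith K (fun x => (thetaT r c w x)⁻¹) ∧ ∀ x, |(thetaT r c w x)⁻¹| ≤ c⁻¹ := by
  obtain ⟨K, hK⟩ := exists_lipschitz_thetaT_box hr hc hV (N := N)
  refine ⟨_, fun w hw => ⟨lipschitzWith_inv_of_ge (hK w hw) hc fun x => le_max_right _ _, fun x => ?_⟩⟩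
  rw [abs_of_pos (inv_pos.2 (thetaT_pos hc w x))]
  exact inv_anti₀ hc (le_max_right _ _)

end Theta

section TestFunction

variable {φ : ℝ → T3 → ℝ} (hφ : Torus.IsSmoothSpaceTimeOn Set.univ φ) (τ : ℝ)
include hφ

/-- A smooth space–time test function is bounded on `[0, τ] × 𝕋³` together with its time derivative and
its partial derivatives, and its slices are uniformly Lipschitz there. [folklore] -/
theorem testFunction_box : ∃ A K : ℝ≥0, ∀ s ∈ Set.Icc 0 τ,
    (∀ x, |φ s x| ≤ A) ∧ (∀ x, |deriv (fun s' => φ s' x) s| ≤ A) ∧ (∀ k x, |pD k (φ s) x| ≤ A)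
      ∧ LipschitzWith K (φ s) := by
  obtain ⟨A₀, hA₀⟩ := hφ.exists_norm_le_of_isCompact isCompact_Icc (Set.subset_univ (Set.Icc 0 τ))
  obtain ⟨At, hAt⟩ := (hφ.timeDerivWithin uniqueDiffOn_univ).exists_norm_le_of_isCompact isCompact_Icc
    (Set.subset_univ (Set.Icc 0 τ))
  have hP := fun k : Fin 3 => (hφ.partialDeriv uniqueDiffOn_univ k).exists_norm_le_of_isCompact isCompact_Icc
    (Set.subset_univ (Set.Icc 0 τ))
  choose Ak hAk using hP
  refine ⟨Real.toNNReal (max (max A₀ At) (∑ k, |Ak k|)), NNReal.sqrt (Fintype.card (Fin 3)) * ∑ k, Real.toNNReal (Ak k),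
    fun s hs => ⟨fun x => ?_, fun x => ?_, fun k x => ?_, ?_⟩⟩
  · have := hA₀ s hs x
    rw [Real.norm_eq_abs] at this
    exact this.trans ((le_max_left _ _).trans ((le_max_left _ _).trans (Real.le_coe_toNNReal _)))
  · have := hAt s hs x
    simp only [Torus.timeDerivWithin, derivWithin_univ, Real.norm_eq_abs] at this
    exact this.trans ((le_max_right _ _).trans ((le_max_left _ _).trans (Real.le_coe_toNNReal _)))
  · have := hAk k s hs x
    rw [Real.norm_eq_abs] at this
    refine this.trans ((le_abs_self _).trans ?_)
    refine (Finset.single_le_sum (f := fun k => |Ak k|) (fun k _ => abs_nonneg _) (Finset.mem_univ k)).trans ?_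
    exact (le_max_right _ _).trans (Real.le_coe_toNNReal _)
  · exact Torus.lipschitzWith_of_norm_partialDeriv_le ((hφ.isSmooth_slice (Set.mem_univ s)).isContDiff (by simp))
      (M := fun k => Real.toNNReal (Ak k)) fun k x => (hAk k s hs x).trans (Real.le_coe_toNNReal _)

end TestFunction

section PhiTheta

variable {r c V : ℝ} (hr : 0 < r) (hc : 0 < c) (hV : 0 ≤ V)
  {φ : ℝ → T3 → ℝ} (hφ : Torus.IsSmoothSpaceTimeOn Set.univ φ) (τ : ℝ)
include hr hc hV hφ

/-- **`φ/θ_r` (twin) is uniformly Lipschitz** over `[0, τ]` and the box, hence `|∂ₖ(φ/θ_r)|` is uniformly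
bounded there. [folklore] -/
theorem exists_lipschitz_phi_div_thetaT_box :
    ∃ K, ∀ s ∈ Set.Icc 0 τ, ∀ w ∈ KV N V, LipschitzWith K fun y => φ s y / thetaT r c w y := by
  obtain ⟨A, Kφ, hAK⟩ := testFunction_box hφ τ
  obtain ⟨Kθ, hKθ⟩ := exists_lipschitz_inv_thetaT_box hr hc hV (N := N)
  refine ⟨?_, fun s hs w hw => ?_⟩
  swap
  obtain ⟨hA, -, -, hL⟩ := hAK s hs
  obtain ⟨h1, h1A⟩ := hKθ w hw
  have h := lipschitzWith_mul_bounded hL h1 hA h1A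
  simpa only [div_eq_mul_inv] using h

end PhiTheta

end L

/-- **Registered sub-goal `ledgerL_honestA`** of stub `stub_ledger` (line `exact-entropy-ledger-three-passivities`):
Along a good orbit all particle speeds are bounded by the conserved kinetic energy. [folklore] -/
theorem ledgerL_honestA :
  ∀ {N : ℕ} {σ : ℝ} (Φ : Flow σ N) {z : Phase N}, z ∈ Φ.good → ∀ s : ℝ, Φ.flow s z ∈ L.KV N (Real.sqrt (2 * configEnergy z)) := by
  intro N σ Φ z hz s
  exact L.flow_mem_KV Φ hz s

end Summit.AtomisticToContinuum.HydrodynamicLimit.Theorems.LocalSecondLawLedger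

end
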